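import Literature.NumberTheory.Transcendental.AnalytificationFunctorialityProofs
import HarnessLib

/-!
# Holomorphy into an analytification is tested on regular functions (proof file)

Companion of `Literature/NumberTheory/Transcendental/AnalytificationFunctorialityProofs.lean`.
That file proves Serre's functoriality `X ↦ X^h` (GAGA §2 n°5 p. 9): for analytifications
`φ : M → X(ℂ)`, `ψ : M' → Y(ℂ)` and a morphism `g : X ⟶ Y`, the map `ψ⁻¹ ∘ g(ℂ) ∘ φ` is
holomorphic. Its proof only uses, about the source side, that the coordinate functions
`xᵢ ∘ g(ℂ) ∘ φ` are holomorphic on `M`. We record the criterion this really establishes, which is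
how one proves in practice that a *transcendental* map into `X^an` (a uniformization
`𝔹 → Γ\𝔹 = X(ℂ)`, a period map, an exponential) is holomorphic:

`IsAnalytification.mdifferentiableAt_of_comp_regular`: let `ψ : M' → Y(ℂ)` be an analytification
with holomorphic atlas of the smooth `k`-scheme `Y` and `h : N → M'` a map from a complex charted
space, continuous at `m`. If for every affine open `V ∋ ψ(h m)` and every regular function
`s ∈ Γ(Y, V)` the function `s ∘ ψ ∘ h` is holomorphic at `m`, then `h` is holomorphic at `m`.

Proof: verbatim Steps 1–4 of the functoriality proof (standard smooth presentation of an affine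
neighbourhood, injectivity of the free algebraic coordinates near `h m` by the implicit function
theorem, Clements–Osgood to make them a holomorphic chart `T` of `M'`), then
`h = χ'⁻¹ ∘ T⁻¹ ∘ (x_free ∘ ψ ∘ h)` near `m` with `x_free ∘ ψ ∘ h` holomorphic by hypothesis. This
is Serre's remark that at a simple point the local analytic coordinates of `X^h` are regular
functions (GAGA §2 n°6 Prop. 3 Cor. 2 with §1 n°4), so holomorphy of a map into `X^h` is read on
regular functions.

## Maintenance

2026-08-21 (ops-buildfix lane, LEDGER row C-7): comment-only re-land, no declaration changed. This
module is the lowest common tree import of the `ShimuraVarieties.UnitaryBall*` packet whose hub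
`.trace` files were copied from another workspace and disagree with the `.olean`s beside them; a
fresh build of this file changes the dependency hash of that whole cone, so Lake rebuilds the
packet from its current sources instead of trusting the stale artefacts.

## References

* J.-P. Serre, *Géométrie algébrique et géométrie analytique*, Ann. Inst. Fourier **6** (1956),
  §1 n°4, §2 n°5–6.
* K. Fritzsche, H. Grauert, *From Holomorphic Functions to Complex Manifolds*, GTM 213 (2002),
  Ch. I §8, Thm. 8.5.
-/

noncomputable section

open CategoryTheory AlgebraicGeometry Topology Filter
open scoped Manifold ContDiff

namespace Literature.NumberTheory.Transcendental

open Literature.AlgebraicGeometry.Motives (ComplexPoints AlgPoints)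
open Literature.AlgebraicGeometry.Motives.AlgPoints

namespace IsAnalytification

variable {E' : Type*} [NormedAddCommGroup E'] [NormedSpace ℂ E'] [FiniteDimensional ℂ E']
  {M' : Type*} [TopologicalSpace M'] [ChartedSpace E' M']
  {E₀ : Type*} [NormedAddCommGroup E₀] [NormedSpace ℂ E₀] {N : Type*} [TopologicalSpace N]
  [ChartedSpace E₀ N]
  {k : Type} [Field k] [Algebra k ℂ] {Y : Literature.AlgebraicGeometry.Motives.SchemeOver k}

/-- **Holomorphy into `X^an` is tested on regular functions.** Let `ψ : M' → Y(ℂ)` be an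
analytification (holomorphic atlas) of the smooth `k`-scheme `Y` of relative dimension `e`, and
`h : N → M'` a map from a complex charted space, continuous at `m`. If every regular function on
an affine open around `ψ (h m)`, read through `ψ ∘ h`, is holomorphic at `m`, then `h` is
holomorphic at `m`. (At a simple point the local analytic coordinates of `Y^h` are regular
functions: Serre, GAGA §2 n°6 Prop. 3 Cor. 2 with §1 n°4; the coordinates are produced here from a
standard smooth presentation by the implicit function theorem and the Clements–Osgood theorem,
exactly as in `mdifferentiable_comp_map_holds`.)
[cite: SerreGAGA1956, §2 n°5 Prop. 2, n°6 Prop. 3 Cor. 2, §1 n°4]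
[cite: FritzscheGrauert2002, Ch. I §8 Thm. 8.5] -/
theorem mdifferentiableAt_of_comp_regular {e : ℕ} [SmoothOfRelativeDimension e Y.hom]
    [IsManifold 𝓘(ℂ, E') ω M'] {ψ : M' → ComplexPoints Y}
    (hψ : IsAnalytification E' Y e ψ) {h : N → M'} {m : N} (hcont : ContinuousAt h m)
    (hreg : ∀ V : Y.left.Opens, IsAffineOpen V → (ψ (h m)).pt ∈ V → ∀ s : Γ(Y.left, V),
      MDifferentiableAt 𝓘(ℂ, E₀) 𝓘(ℂ, ℂ)
        (fun m' ↦ evalOrZero V s (ψ (h m'))) m) :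
    MDifferentiableAt 𝓘(ℂ, E₀) 𝓘(ℂ, E') h m := by
  classical
  haveI : IsManifold 𝓘(ℂ, E') 1 M' := inferInstance
  haveI : CompleteSpace E' := FiniteDimensional.complete ℂ E'
  have hψinj : Function.Injective ψ := hψ.isHomeomorph.injective
  /- Step 1: a standard smooth presentation `Γ(Y, V) = k[Xᵢ]/(fⱼ)` on an affine open `V`
  containing `y = (ψ (h m)).pt` (the base affine open is all of `Spec k`, a one-point space). -/
  obtain ⟨U', hU', V, hV, hyV, eVU, hstd⟩ :=
    SmoothOfRelativeDimension.exists_isStandardSmoothOfRelativeDimension (n := e) (f := Y.hom)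
      (ψ (h m)).pt
  obtain rfl : U' = ⊤ := by
    refine eq_top_iff.2 fun p _ ↦ ?_
    have hy : Y.hom.base (ψ (h m)).pt ∈ U' := eVU hyV
    rwa [Subsingleton.elim p (Y.hom.base (ψ (h m)).pt)]
  letI alg : Algebra Γ(Spec (.of k), ⊤) Γ(Y.left, V) := (Y.hom.appLE ⊤ V eVU).hom.toAlgebra
  have halg : algebraMap Γ(Spec (.of k), ⊤) Γ(Y.left, V) = (Y.hom.appLE ⊤ V eVU).hom := rfl
  obtain ⟨ι, σ, _, _, P, hPdim⟩ := hstd.toAlgebra.out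
  cases nonempty_fintype ι
  cases nonempty_fintype σ
  -- the relations over `ℂ` and the coordinate functions on `Y(ℂ)`
  set F : σ → MvPolynomial ι ℂ := fun j ↦
    MvPolynomial.map ((algebraMap k ℂ).comp (Scheme.ΓSpecIso (.of k)).hom.hom) (P.relation j)
    with hF
  set xf : ι → ComplexPoints Y → ℂ := fun i ↦ evalOrZero V (P.val i) with hxf
  set Q : ComplexPoints Y := ψ (h m) with hQdef
  have hQV : Q.pt ∈ V := hyV
  /- Step 2 (algebra): `x : V(ℂ) → ℂ^ι` is injective, lands in the zero set of the `F j`, and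
  the Jacobian of the `F j` in the distinguished variables does not vanish at `x(Q)`. -/
  have hrel : ∀ R : ComplexPoints Y, R.pt ∈ V →
      ∀ j, MvPolynomial.eval (fun i ↦ xf i R) (F j) = 0 := by
    intro R hR j
    have := eval_map_relation eVU halg P.toPresentation R hR j
    simp only [hxf, evalOrZero_of_mem _ hR]
    exact this
  have hinjV : ∀ R R' : ComplexPoints Y, R.pt ∈ V → R'.pt ∈ V →
      (∀ i, xf i R = xf i R') → R = R' := by
    intro R R' hR hR' hx
    refine ext_of_forall_eval_val_eq hV eVU halg P.toGenerators hR hR' fun i ↦ ?_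
    have := hx i
    simp only [hxf] at this
    rwa [evalOrZero_of_mem _ hR, evalOrZero_of_mem _ hR'] at this
  have hdet : (Matrix.of fun i j : σ ↦ MvPolynomial.eval (fun l ↦ xf l Q)
      (MvPolynomial.pderiv (P.map i) (F j))).det ≠ 0 := by
    have := det_eval_pderiv_relation_ne_zero eVU halg P Q hQV
    simp only [hxf, evalOrZero_of_mem _ hQV]
    exact this
  /- Step 3 (implicit functions): near `x(Q)`, points of `ℂ^ι` in the zero set are determined by
  their free coordinates; hence the free coordinates `xᵢ ∘ ψ`, `i ∉ c(σ)`, are injective on a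
  neighbourhood `N₁` of `h m` in `M'`. -/
  obtain ⟨W, hWo, hcW, hWinj⟩ :=
    exists_isOpen_injOn_of_det_ne_zero P.map P.map_inj F (fun l ↦ xf l Q) hdet
  set N₁ : Set M' := ψ ⁻¹' {R | R.pt ∈ V} ∩ (fun m'' ↦ fun l ↦ xf l (ψ m'')) ⁻¹' W with hN₁
  have hN₁o : IsOpen N₁ := by
    refine ContinuousOn.isOpen_inter_preimage ?_ (hψ.isOpen_preimage V) hWo
    refine continuousOn_pi.2 fun l ↦ ?_
    exact (continuousOn_evalOrZero V (P.val l)).comp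
      hψ.isHomeomorph.continuous.continuousOn fun m'' hm'' ↦ hm''
  have hmN₁ : h m ∈ N₁ := ⟨hQV, hcW⟩
  have hinjN₁ : ∀ m₁ ∈ N₁, ∀ m₂ ∈ N₁,
      (∀ i : {i : ι // i ∉ Set.range P.map}, xf i.1 (ψ m₁) = xf i.1 (ψ m₂)) → m₁ = m₂ := by
    intro m₁ hm₁ m₂ hm₂ hfree
    apply hψinj
    refine hinjV _ _ hm₁.1 hm₂.1 fun i ↦ ?_
    have key := hWinj _ hm₁.2 _ hm₂.2 (fun i hi ↦ hfree ⟨i, hi⟩)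
      (fun j ↦ by rw [hrel _ hm₁.1, hrel _ hm₂.1])
    exact congrFun key i
  /- Step 4 (Osgood): in the chart `χ'` of `M'` at `h m`, `T = x_free ∘ ψ ∘ χ'⁻¹` is an
  injective holomorphic map between open subsets of `e`-dimensional spaces, so its differential
  at `χ' (h m)` is invertible and `T` has a holomorphic local inverse. -/
  set χ' : OpenPartialHomeomorph M' E' := chartAt E' (h m) with hχ'
  set O : Set E' := χ'.target ∩ χ'.symm ⁻¹' N₁ with hO
  have hOo : IsOpen O := χ'.isOpen_inter_preimage_symm hN₁o
  set T : E' → ({i : ι // i ∉ Set.range P.map} → ℂ) :=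
    fun z i ↦ xf i.1 (ψ (χ'.symm z)) with hT
  have hz₀ : χ' (h m) ∈ O :=
    ⟨χ'.map_source (mem_chart_source E' (h m)), by
      show χ'.symm (χ' (h m)) ∈ N₁
      rw [χ'.left_inv (mem_chart_source E' (h m))]
      exact hmN₁⟩
  have hyM' : ∀ i, MDifferentiableOn 𝓘(ℂ, E') 𝓘(ℂ, ℂ) (fun m'' ↦ xf i (ψ m''))
      (ψ ⁻¹' {R | R.pt ∈ V}) :=
    fun i ↦ hψ.mdifferentiableOn_evalOrZero ⟨V, hV⟩ (P.val i)
  have hTd : DifferentiableOn ℂ T O := by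
    intro z hz
    suffices hd : DifferentiableAt ℂ T z from hd.differentiableWithinAt
    refine differentiableAt_pi.2 fun i ↦ ?_
    have h1 : MDifferentiableAt 𝓘(ℂ, E') 𝓘(ℂ, ℂ) (fun m'' ↦ xf i.1 (ψ m'')) (χ'.symm z) :=
      (hyM' i.1).mdifferentiableAt ((hψ.isOpen_preimage _).mem_nhds hz.2.1)
    have h2 : MDifferentiableAt 𝓘(ℂ, E') 𝓘(ℂ, E') χ'.symm z :=
      mdifferentiableAt_atlas_symm (chart_mem_atlas E' (h m)) hz.1
    exact mdifferentiableAt_iff_differentiableAt.1 (h1.comp z h2)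
  have hTinj : Set.InjOn T O := by
    intro z hz z' hz' hzz'
    have : χ'.symm z = χ'.symm z' := hinjN₁ _ hz.2 _ hz'.2 fun i ↦ congrFun hzz' i
    rw [← χ'.right_inv hz.1, ← χ'.right_inv hz'.1, this]
  have hcard : Fintype.card {i : ι // i ∉ Set.range P.map} = e := by
    rw [Fintype.card_subtype_compl]
    change Fintype.card ι - Fintype.card (Set.range P.map) = e
    rw [Set.card_range_of_injective P.map_inj, ← hPdim, Algebra.Presentation.dimension,
      Nat.card_eq_fintype_card, Nat.card_eq_fintype_card]
  have hdim : Module.finrank ℂ E' = Module.finrank ℂ ({i : ι // i ∉ Set.range P.map} → ℂ) := by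
    rw [hψ.finrank_eq, Module.finrank_fintype_fun_eq_card, hcard]
  have hbij := Literature.Analysis.Complex.SCV.bijective_fderiv_of_injOn hdim hTd hOo hTinj hz₀
  set Λ : E' ≃L[ℂ] ({i : ι // i ∉ Set.range P.map} → ℂ) :=
    ContinuousLinearEquiv.ofBijective (fderiv ℂ T (χ' (h m))) (LinearMap.ker_eq_bot.2 hbij.1)
      (LinearMap.range_eq_top.2 hbij.2) with hΛ
  have hstrict : HasStrictFDerivAt T (Λ : E' →L[ℂ] _) (χ' (h m)) := by
    rw [hΛ, ContinuousLinearEquiv.coe_ofBijective]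
    exact ((Literature.Analysis.Complex.SCV.contDiffOn_one hTd hOo).contDiffAt
      (hOo.mem_nhds hz₀)).hasStrictFDerivAt
      one_ne_zero
  /- Step 5 (Serre's argument): `A = x_free ∘ g(ℂ) ∘ φ` is holomorphic at `m`, since
  `xᵢ ∘ g(ℂ) ∘ φ = (g^* xᵢ) ∘ φ` is a regular function of `X` read on `M`. -/
  set A : N → ({i : ι // i ∉ Set.range P.map} → ℂ) :=
    fun m'' i ↦ xf i.1 (ψ (h m'')) with hA
  have hAd : MDifferentiableAt 𝓘(ℂ, E₀) 𝓘(ℂ, {i : ι // i ∉ Set.range P.map} → ℂ) A m := by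
    rw [← mdifferentiableWithinAt_univ]
    refine Literature.Geometry.Kaehler.mdifferentiableWithinAt_pi_space.2 fun i ↦ ?_
    rw [mdifferentiableWithinAt_univ]
    have heq : (fun m'' ↦ A m'' i) =
        fun m'' ↦ evalOrZero V (P.val i.1) (ψ (h m'')) := by
      funext m''
      simp only [hA, hxf]
    rw [heq]
    exact hreg V hV hQV (P.val i.1)
  -- near `m`, `h = χ'⁻¹ ∘ T⁻¹ ∘ A`
  have hTA : ∀ m'', h m'' ∈ χ'.source → T (χ' (h m'')) = A m'' := by
    intro m'' hm''
    funext i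
    simp only [hT, hA, χ'.left_inv hm'']
  have hev : h =ᶠ[𝓝 m] fun m'' ↦ χ'.symm (hstrict.localInverse T _ _ (A m'')) := by
    have h1 : ∀ᶠ m'' in 𝓝 m, h m'' ∈ χ'.source :=
      hcont.preimage_mem_nhds (χ'.open_source.mem_nhds (mem_chart_source E' (h m)))
    have h2 : ∀ᶠ m'' in 𝓝 m, hstrict.localInverse T _ _ (T (χ' (h m''))) = χ' (h m'') := by
      have hc : ContinuousAt (fun m'' ↦ χ' (h m'')) m :=
        (χ'.continuousAt (mem_chart_source E' (h m))).comp hcont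
      exact hc.eventually hstrict.eventually_left_inverse
    filter_upwards [h1, h2] with m'' hm1 hm2
    rw [← hTA m'' hm1, hm2, χ'.left_inv hm1]
  refine MDifferentiableAt.congr_of_eventuallyEq ?_ hev
  have hTm : T (χ' (h m)) = A m := hTA m (mem_chart_source E' (h m))
  have h1 : MDifferentiableAt 𝓘(ℂ, {i : ι // i ∉ Set.range P.map} → ℂ) 𝓘(ℂ, E')
      (hstrict.localInverse T _ _) (A m) := by
    rw [← hTm]
    exact mdifferentiableAt_iff_differentiableAt.2
      hstrict.to_localInverse.hasFDerivAt.differentiableAt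
  have h2 : MDifferentiableAt 𝓘(ℂ, E') 𝓘(ℂ, E') χ'.symm (hstrict.localInverse T _ _ (A m)) := by
    rw [← hTm, hstrict.localInverse_apply_image]
    exact mdifferentiableAt_atlas_symm (chart_mem_atlas E' (h m))
      (χ'.map_source (mem_chart_source E' (h m)))
  exact h2.comp m (h1.comp m hAd)

end IsAnalytification

end Literature.NumberTheory.Transcendental
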